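import Mathlib
import Summits.MatrixMultiplication.MatrixMultiplication.Theorems.HiddenToeplitzCornersHiddenCornerLemmaRTailSlot

/-!
# Approximate X-descent: a frame with a short approximate syzygy carries no common target

Support file for crux item `stmt-MatrixMultiplication-10752`
(`Summit.MatrixMultiplication.MatrixMultiplication.Theses.HiddenToeplitzCorners.HiddenCornerLemmaR`),
line `atkinson-lloyd-core-split`, stub `hclR_x_descent_approx` (theorem (G1'): the X-descent
theorem for the `G`-constant class in its gauge-invariant, approximate-syzygy form; general
frames, all `p`).

Model `ℂ^N = ℂ[X]/(X^N)`: a column `e` is a polynomial of degree `< N`, and the *tail* of `e`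
against a constant vector `v` is `κ(v, e) = ∑_i v_i · (e /ₘ X^i)`; the class member with
coefficient tails `η_{b k}` sends `e_c` to `∑_k g_k κ(η_{b k}, e_c) (mod X^N)`.

An *approximate syzygy* of degree `μ` of the frame `e` is a family `P` with `deg P_c ≤ μ`, the
degree `μ` attained at some slot, and `deg (∑_c P_c e_c) < μ` (the combination is shorter than
the longest coefficient).  Unlike exact syzygies (`∑_c P_c e_c = 0`, file `…XDescent`) these are
invariant under the frame-side symmetry `E ↦ w(δ) E` of designs, and they exist from degree
`≈ N / r` on.

* `hclR_tail_lowdeg_approx`, `hclR_tail_lowdeg_corr_approx` — TAILS OF AN APPROXIMATE SYZYGY ARE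
  SHORT: `deg P_c ≤ μ` and `coeff_n (∑_c P_c e_c) = 0` for `n ≥ μ` imply that
  `∑_c P_c (e_c /ₘ X^m)` and `∑_c P_c κ(v, e_c)` have no coefficient in degrees `≥ μ`
  (the identity `X^m ∑_c P_c (e_c /ₘ X^m) + ∑_c P_c (e_c mod X^m) = ∑_c P_c e_c` read in
  degree `K + m`, `K ≥ μ`).
* `hclR_x_descent_approx` — APPROXIMATE X-DESCENT THEOREM.  Data: generators `g_k`, a frame `e_c`
  (`deg < N`), a candidate common target `φ` (`deg < N`), an approximate syzygy `P` of degree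
  `μ`, the hypothesis "no short generator syzygy of length `2μ`" (every `β` with coefficients
  vanishing from degree `2μ` on and `X^N ∣ ∑_k g_k β_k` is `0`), and the corner hypothesis
  `∑_k g_k κ(η_{b k}, e_c) ≡ [b = c] φ (mod X^N)` for all slots `b, c`.  Then `φ = 0`.
  Proof: (0) divide `P` by a generator `D` of the ideal `(P_c)_c`: `P = D • Q` with a Bezout
  relation `∑_c a_c Q_c = 1`; at the slot `c₀` where `deg P_{c₀} = μ` the degree
  `μ₀ := deg Q_{c₀} = μ - deg D` is maximal among the `deg Q_c`, and
  `∑_c Q_c e_c = (∑_c P_c e_c) / D` is still shorter than `μ₀` (exact division in `ℂ[X]`), so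
  `Q` is again an approximate syzygy, of degree `μ₀ ≤ μ`; (1) TAILS ARE SHORT:
  `S_{b k} := ∑_c Q_c κ(η_{b k}, e_c)` has no coefficient from degree `μ₀` on; (2) summing the
  corner hypothesis against `Q` and cross-multiplying two slots gives
  `X^N ∣ ∑_k g_k (Q_c S_{b k} - Q_b S_{c k})` with brackets vanishing from degree `2μ` on, so all
  brackets vanish; (3) by Bezout `S_{b k} = Q_b θ_k`, and comparing degrees at `c₀` forces
  `θ_k = 0`, whence `X^N ∣ Q_b φ` for every `b` and, by Bezout again, `X^N ∣ φ`, `φ = 0`.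
  Pure polynomial algebra; nothing beyond Mathlib.
-/

-- D-0017: the single-problem layout `Summits/<S>/<S>/…` duplicates a namespace segment by design.
set_option linter.dupNamespace false

namespace Summit.MatrixMultiplication.MatrixMultiplication.Theorems

open Polynomial BigOperators Finset

/-- **Tails of an approximate syzygy are short.**  If `deg P_c ≤ μ` and `∑_c P_c e_c` has no
coefficient in degrees `≥ μ`, then `∑_c P_c · (e_c /ₘ X^m)` has no coefficient in degrees `≥ μ`:
`X^m ∑_c P_c (e_c /ₘ X^m) + ∑_c P_c (e_c mod X^m) = ∑_c P_c e_c`, and in degree `K + m` with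
`K ≥ μ` neither the second sum (degree `< μ + m`) nor the right-hand side has a coefficient. -/
theorem hclR_tail_lowdeg_approx {ι : Type*} [Fintype ι] (μ m : ℕ) (P e : ι → ℂ[X])
    (hP : ∀ c, (P c).natDegree ≤ μ) (hsyz : ∀ n, μ ≤ n → (∑ c, P c * e c).coeff n = 0)
    (K : ℕ) (hK : μ ≤ K) :
    (∑ c, P c * (e c /ₘ X ^ m)).coeff K = 0 := by
  have hdec : ∀ c, e c %ₘ X ^ m + X ^ m * (e c /ₘ X ^ m) = e c :=
    fun c => modByMonic_add_div (e c) (X ^ m)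
  have key : X ^ m * ∑ c, P c * (e c /ₘ X ^ m) + ∑ c, P c * (e c %ₘ X ^ m) = ∑ c, P c * e c := by
    rw [Finset.mul_sum, ← Finset.sum_add_distrib]
    refine Finset.sum_congr rfl fun c _ => ?_
    conv_rhs => rw [← hdec c]
    ring
  have hrem : (∑ c, P c * (e c %ₘ X ^ m)).coeff (K + m) = 0 := by
    rw [finsetSum_coeff]
    refine Finset.sum_eq_zero fun c _ => ?_
    by_cases hr : e c %ₘ X ^ m = 0
    · rw [hr, mul_zero, coeff_zero]
    apply coeff_eq_zero_of_natDegree_lt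
    have hdeg : (e c %ₘ X ^ m).natDegree < m := by
      rw [natDegree_lt_iff_degree_lt hr]
      calc (e c %ₘ X ^ m).degree < ((X : ℂ[X]) ^ m).degree :=
          degree_modByMonic_lt _ (monic_X_pow m)
        _ = m := degree_X_pow m
    calc (P c * (e c %ₘ X ^ m)).natDegree ≤ (P c).natDegree + (e c %ₘ X ^ m).natDegree :=
        natDegree_mul_le
      _ < K + m := by have := hP c; omega
  have hKm : μ ≤ K + m := by omega
  have h2 := congrArg (fun q : ℂ[X] => q.coeff (K + m)) key
  rw [coeff_add, coeff_X_pow_mul, hrem, add_zero, hsyz (K + m) hKm] at h2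
  exact h2

/-- Tails against any constant vector `v` of an approximate syzygy of degree `μ` are short:
if `deg P_c ≤ μ` and `∑_c P_c e_c` has no coefficient in degrees `≥ μ`, then
`∑_c P_c κ(v, e_c)` has no coefficient in degrees `≥ μ`, `κ(v, e) = ∑_i v_i (e /ₘ X^i)`. -/
theorem hclR_tail_lowdeg_corr_approx {ι : Type*} [Fintype ι] {N : ℕ} (μ : ℕ) (v : Fin N → ℂ)
    (P e : ι → ℂ[X]) (hP : ∀ c, (P c).natDegree ≤ μ)
    (hsyz : ∀ n, μ ≤ n → (∑ c, P c * e c).coeff n = 0) (K : ℕ) (hK : μ ≤ K) :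
    (∑ c, P c * ∑ i : Fin N, C (v i) * (e c /ₘ X ^ (i : ℕ))).coeff K = 0 := by
  have e1 : ∑ c, P c * ∑ i : Fin N, C (v i) * (e c /ₘ X ^ (i : ℕ)) =
      ∑ i : Fin N, C (v i) * ∑ c, P c * (e c /ₘ X ^ (i : ℕ)) := by
    simp only [Finset.mul_sum]
    rw [Finset.sum_comm]
    exact Finset.sum_congr rfl fun i _ => Finset.sum_congr rfl fun c _ => by ring
  rw [e1, finsetSum_coeff]
  exact Finset.sum_eq_zero fun i _ => by
    rw [coeff_C_mul, hclR_tail_lowdeg_approx μ i P e hP hsyz K hK, mul_zero]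

-- The next three helpers are adapted from the private helpers of
-- `Summits.MatrixMultiplication.MatrixMultiplication.Theorems.HiddenToeplitzCornersHiddenCornerLemmaRXDescent`.

/-- A polynomial whose coefficients vanish from degree `M` on is zero or has `natDegree < M`. -/
private theorem hclR_xda_natDegree_lt (p : ℂ[X]) (M : ℕ) (hp : ∀ K, M ≤ K → p.coeff K = 0)
    (hz : p ≠ 0) : p.natDegree < M := by
  by_contra h
  have := hp _ (not_lt.mp h)
  rw [coeff_natDegree, leadingCoeff_eq_zero] at this
  exact hz this

/-- If `deg Q ≤ μ` and the coefficients of `S` vanish from degree `μ₀` on, then the coefficients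
of `Q * S` vanish from degree `μ + μ₀` on. -/
private theorem hclR_xda_coeff_mul_eq_zero {Q S : ℂ[X]} {μ μ₀ n : ℕ} (hQ : Q.natDegree ≤ μ)
    (hS : ∀ K, μ₀ ≤ K → S.coeff K = 0) (hn : μ + μ₀ ≤ n) : (Q * S).coeff n = 0 := by
  rw [coeff_mul]
  refine Finset.sum_eq_zero fun ij hij => ?_
  have hij' : ij.1 + ij.2 = n := by simpa using hij
  rcases lt_or_ge μ ij.1 with h | h
  · rw [coeff_eq_zero_of_natDegree_lt (hQ.trans_lt h), zero_mul]
  · rw [hS ij.2 (by omega), mul_zero]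

/-- **Coprime reduction of a family.**  A family `P` of polynomials over `ℂ` with a nonzero
entry `P c₁` is `D • Q` for a nonzero `D` (a generator of the ideal spanned by the family) and a
family `Q` with a Bezout relation `∑_c a_c Q_c = 1`. -/
private theorem hclR_xda_coprime_reduction {r : ℕ} (P : Fin r → ℂ[X]) (c₁ : Fin r)
    (hc₁ : P c₁ ≠ 0) :
    ∃ (D : ℂ[X]) (Q a : Fin r → ℂ[X]), D ≠ 0 ∧ (∀ c, P c = D * Q c) ∧ ∑ c, a c * Q c = 1 := by
  classical
  let I : Ideal ℂ[X] := Ideal.span (Set.range P)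
  have hdvd : ∀ c, Submodule.IsPrincipal.generator I ∣ P c := fun c =>
    (Submodule.IsPrincipal.mem_iff_generator_dvd I).mp (Ideal.subset_span (Set.mem_range_self c))
  choose Q hQ using hdvd
  obtain ⟨a, ha⟩ := Ideal.mem_span_range_iff_exists_fun.mp (Submodule.IsPrincipal.generator_mem I)
  have hD0 : Submodule.IsPrincipal.generator I ≠ 0 := by
    intro h
    apply hc₁
    rw [hQ c₁, h, zero_mul]
  refine ⟨Submodule.IsPrincipal.generator I, Q, a, hD0, hQ, mul_left_cancel₀ hD0 ?_⟩
  rw [mul_one, Finset.mul_sum]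
  conv_rhs => rw [← ha]
  exact Finset.sum_congr rfl fun c _ => by rw [hQ c]; ring

/-- **Approximate X-descent theorem.**  Let `g_k` be generators, `e_c` a frame and `φ` a
candidate common target (all of degree `< N`), and `P` an approximate frame syzygy of degree `μ`
(`deg P_c ≤ μ`, `deg P_c = μ` attained at a slot with `P_c ≠ 0`, and `∑_c P_c e_c` without
coefficients from degree `μ` on).  If the generators have no short syzygy of length `2μ` (every
`β` with coefficients vanishing from degree `2μ` on and `X^N ∣ ∑_k g_k β_k` is zero) and the class
member with coefficient tails `η_{b k}` kills `e_c` for `c ≠ b` and sends `e_b` to `φ` modulo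
`X^N`, i.e. `X^N ∣ ∑_k g_k κ(η_{b k}, e_c) - [b = c] φ` with `κ(v, e) = ∑_i v_i (e /ₘ X^i)`, then
`φ = 0`. -/
theorem hclR_x_descent_approx :
    ∀ (N p r μ : ℕ) (g : Fin p → Polynomial ℂ) (η : Fin r → Fin p → Fin N → ℂ)
      (e P : Fin r → Polynomial ℂ) (φ : Polynomial ℂ),
      (∀ (c : Fin r) (n : ℕ), N ≤ n → (e c).coeff n = 0) → (∀ n : ℕ, N ≤ n → φ.coeff n = 0) →
      (∀ c : Fin r, (P c).natDegree ≤ μ) → (∃ c : Fin r, (P c).natDegree = μ ∧ P c ≠ 0) →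
      (∀ n : ℕ, μ ≤ n → (∑ c : Fin r, P c * e c).coeff n = 0) →
      (∀ β : Fin p → Polynomial ℂ, (∀ (k : Fin p) (n : ℕ), 2 * μ ≤ n → (β k).coeff n = 0) →
        (Polynomial.X : Polynomial ℂ) ^ N ∣ (∑ k : Fin p, g k * β k) → β = 0) →
      (∀ b c : Fin r, (Polynomial.X : Polynomial ℂ) ^ N ∣
        (∑ k : Fin p, g k * ∑ i : Fin N, Polynomial.C (η b k i) *
          (e c /ₘ (Polynomial.X : Polynomial ℂ) ^ (i : ℕ))) - (if b = c then φ else 0)) →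
      φ = 0 := by
  intro N p r μ g η e P φ _he hφ hPdeg hPμ hsyz hshort hcorner
  classical
  -- tails of the frame against the coefficient vectors `η b k`
  obtain ⟨κ, hκ⟩ : ∃ κ : Fin r → Fin p → Fin r → ℂ[X],
      ∀ b k c, κ b k c = ∑ i : Fin N, C (η b k i) * (e c /ₘ X ^ (i : ℕ)) := ⟨_, fun _ _ _ => rfl⟩
  simp only [← hκ] at hcorner
  -- the slot `c₀` where the degree `μ` is attained
  obtain ⟨c₀, hc₀μ, hPc₀⟩ := hPμ
  -- (0) coprime reduction: `P = D • Q`, `∑_c a_c Q_c = 1`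
  obtain ⟨D, Q, a, hD0, hPQ, hbez⟩ := hclR_xda_coprime_reduction P c₀ hPc₀
  have hQc₀ : Q c₀ ≠ 0 := by
    intro h
    apply hPc₀
    rw [hPQ c₀, h, mul_zero]
  have hDQ : D.natDegree + (Q c₀).natDegree = μ := by
    rw [← hc₀μ, hPQ c₀, natDegree_mul hD0 hQc₀]
  -- `μ₀ := deg Q c₀` is the maximal degree of the reduced family
  have hQdeg₀ : ∀ c, (Q c).natDegree ≤ (Q c₀).natDegree := by
    intro c
    by_cases hQc : Q c = 0
    · rw [hQc, natDegree_zero]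
      exact Nat.zero_le _
    · have h1 : D.natDegree + (Q c).natDegree ≤ μ := by
        rw [← natDegree_mul hD0 hQc, ← hPQ c]
        exact hPdeg c
      omega
  have hQdeg : ∀ c, (Q c).natDegree ≤ μ := fun c => (hQdeg₀ c).trans (by omega)
  -- `Q` is again an approximate syzygy, of degree `μ₀`: `D * ∑_c Q_c e_c = ∑_c P_c e_c`
  have hQsyz : ∀ n, (Q c₀).natDegree ≤ n → (∑ c, Q c * e c).coeff n = 0 := by
    intro n hn
    have h1 : D * ∑ c, Q c * e c = ∑ c, P c * e c := by
      rw [Finset.mul_sum]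
      exact Finset.sum_congr rfl fun c _ => by rw [hPQ c, mul_assoc]
    by_cases hU : ∑ c, Q c * e c = 0
    · rw [hU, coeff_zero]
    apply coeff_eq_zero_of_natDegree_lt
    have hT : ∑ c, P c * e c ≠ 0 := by
      rw [← h1]
      exact mul_ne_zero hD0 hU
    have h2 : (∑ c, P c * e c).natDegree < μ := hclR_xda_natDegree_lt _ μ hsyz hT
    rw [← h1, natDegree_mul hD0 hU] at h2
    omega
  -- (1) tails are short: `S b k := ∑_c Q_c κ(η b k, e_c)` has no coefficient from `μ₀` on
  obtain ⟨S, hS⟩ : ∃ S : Fin r → Fin p → ℂ[X], ∀ b k, S b k = ∑ c, Q c * κ b k c :=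
    ⟨_, fun _ _ => rfl⟩
  have hSμ₀ : ∀ b k K, (Q c₀).natDegree ≤ K → (S b k).coeff K = 0 := by
    intro b k K hK
    rw [hS]
    simp only [hκ]
    exact hclR_tail_lowdeg_corr_approx (Q c₀).natDegree (η b k) Q e hQdeg₀ hQsyz K hK
  have hSμ : ∀ b k K, μ ≤ K → (S b k).coeff K = 0 := fun b k K hK => hSμ₀ b k K (by omega)
  -- (2) sum the corner hypotheses of row `b` against `Q`
  have hrow : ∀ b, (X : ℂ[X]) ^ N ∣ (∑ k, g k * S b k) - Q b * φ := by
    intro b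
    have h1 : (∑ k, g k * S b k) - Q b * φ =
        ∑ c, Q c * ((∑ k, g k * κ b k c) - (if b = c then φ else 0)) := by
      simp only [mul_sub, Finset.sum_sub_distrib, hS, Finset.mul_sum, mul_ite, mul_zero,
        Finset.sum_ite_eq, Finset.mem_univ, if_true]
      congr 1
      rw [Finset.sum_comm]
      exact Finset.sum_congr rfl fun c _ => Finset.sum_congr rfl fun k _ => by ring
    rw [h1]
    exact Finset.dvd_sum fun c _ => dvd_mul_of_dvd_right (hcorner b c) _
  -- cross-multiplying two slots: the brackets are short generator syzygies, hence vanish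
  have hcross : ∀ b c k, Q c * S b k = Q b * S c k := by
    intro b c
    have hβ := hshort (fun k => Q c * S b k - Q b * S c k) (fun k n hn => by
      rw [coeff_sub, hclR_xda_coeff_mul_eq_zero (hQdeg c) (hSμ b k) (by omega),
        hclR_xda_coeff_mul_eq_zero (hQdeg b) (hSμ c k) (by omega), sub_zero]) (by
      have h1 : ∑ k, g k * (Q c * S b k - Q b * S c k) =
          Q c * ((∑ k, g k * S b k) - Q b * φ) - Q b * ((∑ k, g k * S c k) - Q c * φ) := by
        rw [mul_sub, mul_sub, Finset.mul_sum, Finset.mul_sum]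
        have h2 : ∑ k, g k * (Q c * S b k - Q b * S c k) =
            ∑ k, Q c * (g k * S b k) - ∑ k, Q b * (g k * S c k) := by
          rw [← Finset.sum_sub_distrib]
          exact Finset.sum_congr rfl fun k _ => by ring
        rw [h2]
        ring
      rw [h1]
      exact dvd_sub (dvd_mul_of_dvd_right (hrow b) _) (dvd_mul_of_dvd_right (hrow c) _))
    intro k
    exact sub_eq_zero.mp (congr_fun hβ k)
  -- (3) parallel vectors: `S b k = Q b * θ k` by Bezout, and `θ k = 0` by degrees at `c₀`
  obtain ⟨θ, hθ⟩ : ∃ θ : Fin p → ℂ[X], ∀ k, θ k = ∑ c, a c * S c k := ⟨_, fun _ => rfl⟩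
  have hSθ : ∀ b k, S b k = Q b * θ k := by
    intro b k
    calc S b k = (∑ c, a c * Q c) * S b k := by rw [hbez, one_mul]
      _ = ∑ c, a c * (Q b * S c k) := by
          rw [Finset.sum_mul]
          exact Finset.sum_congr rfl fun c _ => by rw [mul_assoc, hcross b c k]
      _ = Q b * θ k := by
          rw [hθ, Finset.mul_sum]
          exact Finset.sum_congr rfl fun c _ => by ring
  have hθ0 : ∀ k, θ k = 0 := by
    intro k
    by_contra hθk
    have h2 : (S c₀ k).natDegree < (Q c₀).natDegree :=
      hclR_xda_natDegree_lt (S c₀ k) _ (hSμ₀ c₀ k) (by rw [hSθ]; exact mul_ne_zero hQc₀ hθk)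
    rw [hSθ, natDegree_mul hQc₀ hθk] at h2
    omega
  have hS0 : ∀ b k, S b k = 0 := fun b k => by rw [hSθ, hθ0 k, mul_zero]
  -- hence `X^N ∣ Q b * φ` for every slot, and `X^N ∣ φ` by Bezout
  have hdvdQ : ∀ b, (X : ℂ[X]) ^ N ∣ Q b * φ := by
    intro b
    have h1 := hrow b
    simp only [hS0, mul_zero, Finset.sum_const_zero, zero_sub, dvd_neg] at h1
    exact h1
  have hdvdφ : (X : ℂ[X]) ^ N ∣ φ := by
    have h1 : φ = ∑ b, a b * (Q b * φ) := by
      calc φ = (∑ b, a b * Q b) * φ := by rw [hbez, one_mul]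
        _ = ∑ b, a b * (Q b * φ) := by
            rw [Finset.sum_mul]
            exact Finset.sum_congr rfl fun b _ => by ring
    rw [h1]
    exact Finset.dvd_sum fun b _ => dvd_mul_of_dvd_right (hdvdQ b) _
  by_contra hφ0
  exact hφ0 (eq_zero_of_dvd_of_natDegree_lt hdvdφ
    (by rw [natDegree_X_pow]; exact hclR_xda_natDegree_lt φ N hφ hφ0))

end Summit.MatrixMultiplication.MatrixMultiplication.Theorems
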